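import Literature.Analysis.FluidPDE.PineauVicolOneSliceCKN
import Literature.Analysis.FluidPDE.PineauVicolOneSliceDissipation
import Literature.Analysis.FluidPDE.LocalTypeIScaling
import HarnessLib

/-!
# Pineau–Vicol 2026, Theorem 1.9 — the printed proof: Proposition 9.5 with the dissipation
  input discharged

Analysis/FluidPDE proof file, fourth sibling of `PineauVicolOneSlice.lean` (the named fact
`Literature.Analysis.FluidPDE.pineauVicol2026_oneSlice_regularity`, B. Pineau, V. Vicol,
arXiv:2607.09619 (2026), Thm. 1.9). `PineauVicolOneSliceCKN.lean` proves Prop. 9.5 for the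
solutions of Theorem 1.9 modulo three inputs on the parabolic zoom `(u_c, p_c)`
(`pineauVicol_regular_of_zoom`): (I1) `∇u_c ∈ L²(Q₁)`, (I2) `p_c ∈ L^{3/2}(Q₁)`, (I3) small
dissipation. `PineauVicolOneSliceDissipation.lean` proves `∇u ∈ L²(Q_{1/2})`
(`lintegral_parabolicCylinder_half_fderiv_lt_top`). Here the two are joined through the parabolic
scaling of the dissipation (the tree's `cknE_nsZoom`, `LocalTypeIScaling.lean`):

* `fderiv_nsRescale_eq_smul_stPull` — `Dₓu_c = c² Dₓu ∘ Φ`, `Φ(s, y) = (c²s, cy)` (chain rule for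
  dilations, no differentiability needed);
* `lintegral_parabolicCylinder_one_fderiv_nsRescale` —
  `∫∫_{Q₁} |∇u_c|² = c⁻¹ ∫∫_{Q_c} |∇u|²` (`E` is scale invariant);
* `lintegral_parabolicCylinder_one_fderiv_nsRescale_lt_top` — hence (I1) holds for every zoom
  factor `0 < c ≤ ½` under the hypotheses of Theorem 1.9;
* `pineauVicol_regular_of_zoom_half` — **Prop. 9.5 for the solutions of Theorem 1.9 modulo (I2)
  and (I3) only** (zoom factor `c = ½`): a classical solution on `[−1,0) × B₁` with (1.15)–(1.16)
  whose zoom `(u_{1/2}, p_{1/2})` has `p_{1/2} ∈ L^{3/2}(Q₁)` and `sup_{0<r<1} E(r; u_{1/2}) < ε` is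
  bounded on `B_r × (−r², 0)` for some `r > 0` — the conclusion of the vendored fact verbatim.

What remains for `pineauVicol2026_oneSlice_regularity_holds` is thus exactly: the pressure class
(I2) (the paper's decomposition `p = p_loc + h`, Calderón–Zygmund + the harmonic part bounded via
(1.16)) and the smallness (I3), i.e. the paper's §9.3 (Bernoulli identity against the principal
Dirichlet eigenfunction of `L̄*`, Lemmas 5.3–5.4, Harnack) and Lemma 9.4 (propagation of small
vorticity) — the analytic core of the paper.

## References

* B. Pineau, V. Vicol, arXiv:2607.09619 (2026), Prop. 9.5 and its proof (p. 32–33).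
  [PineauVicol2026]
* L. Caffarelli, R. Kohn, L. Nirenberg, Comm. Pure Appl. Math. 35 (1982), (1.5)–(1.6) (scaling of
  local solutions). [CaffarelliKohnNirenberg1982]
-/

noncomputable section

open Set Metric Function Filter MeasureTheory TopologicalSpace
open _root_.Topology
open scoped ENNReal NNReal

namespace Literature.Analysis.FluidPDE

variable {u : ℝ → EuclideanSpace ℝ (Fin 3) → EuclideanSpace ℝ (Fin 3)}
  {p : ℝ → EuclideanSpace ℝ (Fin 3) → ℝ} {c Cu Cp : ℝ}

/-- **The gradient of the zoom**: `Dₓ(u_c)(s, y) = c² • Dₓu(c²s, cy)`, i.e.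
`(s, y) ↦ Dₓ(u_c(s, ·))(y)` is `c² • stPull (c²) c 0 0 (Dₓu)` (chain rule for the dilation
`y ↦ c u(c²s, cy)`, valid without differentiability by the junk-value conventions,
`fderiv_smul_comp_smul`). [folklore] -/
theorem fderiv_nsRescale_eq_smul_stPull (c : ℝ)
    (u : ℝ → EuclideanSpace ℝ (Fin 3) → EuclideanSpace ℝ (Fin 3)) :
    (fun t x => fderiv ℝ (nsRescale c u t) x) =
      c ^ 2 • stPull (c ^ 2) c 0 (0 : EuclideanSpace ℝ (Fin 3)) fun t x => fderiv ℝ (u t) x := by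
  funext s y
  simp only [Pi.smul_apply, stPull_apply, zero_add]
  exact fderiv_smul_comp_smul (u (c ^ 2 * s)) c y

/-- **Scaling of the dissipation**: `∫∫_{Q₁} |∇u_c|² = c⁻¹ ∫∫_{Q_c} |∇u|²` for `c > 0`
(`E(1; u_c) = E(c; u)`, tree `cknE_nsZoom`). [cite: CaffarelliKohnNirenberg1982, (1.5)–(1.6)] -/
theorem lintegral_parabolicCylinder_one_fderiv_nsRescale (hc : 0 < c)
    (u : ℝ → EuclideanSpace ℝ (Fin 3) → EuclideanSpace ℝ (Fin 3)) :
    ∫⁻ w in parabolicCylinder 1 (0 : ℝ × EuclideanSpace ℝ (Fin 3)),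
        ENNReal.ofReal (frobeniusNormSq (fderiv ℝ (nsRescale c u w.1) w.2)) =
      (ENNReal.ofReal c)⁻¹ * ∫⁻ w in parabolicCylinder c (0 : ℝ × EuclideanSpace ℝ (Fin 3)),
        ENNReal.ofReal (frobeniusNormSq (fderiv ℝ (u w.1) w.2)) := by
  have h1 : ∫⁻ w in parabolicCylinder 1 (0 : ℝ × EuclideanSpace ℝ (Fin 3)),
      ENNReal.ofReal (frobeniusNormSq (fderiv ℝ (nsRescale c u w.1) w.2)) =
      cknE 1 (0 : ℝ × EuclideanSpace ℝ (Fin 3)) (fun t x => fderiv ℝ (nsRescale c u t) x) := by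
    unfold cknE; simp
  have h2 : cknE c (0 : ℝ × EuclideanSpace ℝ (Fin 3)) (fun t x => fderiv ℝ (u t) x) =
      (ENNReal.ofReal c)⁻¹ * ∫⁻ w in parabolicCylinder c (0 : ℝ × EuclideanSpace ℝ (Fin 3)),
        ENNReal.ofReal (frobeniusNormSq (fderiv ℝ (u w.1) w.2)) := rfl
  have h3 : stAffine (c ^ 2) c 0 (0 : EuclideanSpace ℝ (Fin 3)) (0 : ℝ × EuclideanSpace ℝ (Fin 3)) = 0 := by
    simp [stAffine]
  rw [h1, fderiv_nsRescale_eq_smul_stPull, cknE_nsZoom hc one_pos 0 0 0, mul_one, h3, h2]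

/-- **(I1) for the zoom of a solution of Theorem 1.9**: under (1.15)–(1.16), for every zoom factor
`0 < c ≤ ½`, `∫∫_{Q₁} |∇u_c|² < ∞` (from `∇u ∈ L²(Q_{1/2})`,
`lintegral_parabolicCylinder_half_fderiv_lt_top`, and the scaling of the dissipation).
[cite: PineauVicol2026, proof of Prop. 9.5, arXiv:2607.09619 p. 33] -/
theorem lintegral_parabolicCylinder_one_fderiv_nsRescale_lt_top
    (hreg : IsClassicalNSSolutionOnRegion
      (Ico (-1 : ℝ) 0 ×ˢ ball (0 : EuclideanSpace ℝ (Fin 3)) 1) 1 0 u p)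
    (hI : ∀ t ∈ Ico (-1 : ℝ) 0, ∀ x ∈ ball (0 : EuclideanSpace ℝ (Fin 3)) 1,
      ‖u t x‖ ≤ Cu / (Real.sqrt (-t) + ‖x‖))
    (hP : ∀ t ∈ Ico (-1 : ℝ) 0, ∀ x : EuclideanSpace ℝ (Fin 3),
      1 / 2 < ‖x‖ → ‖x‖ < 3 / 4 → |p t x| ≤ Cp)
    (hc : 0 < c) (hc2 : c ≤ 1 / 2) :
    ∫⁻ w in parabolicCylinder 1 (0 : ℝ × EuclideanSpace ℝ (Fin 3)),
      ENNReal.ofReal (frobeniusNormSq (fderiv ℝ (nsRescale c u w.1) w.2)) < ⊤ := by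
  rw [lintegral_parabolicCylinder_one_fderiv_nsRescale hc]
  refine ENNReal.mul_lt_top (ENNReal.inv_lt_top.2 (by simpa using hc)) ?_
  exact lt_of_le_of_lt (lintegral_mono_set (parabolicCylinder_mono hc.le hc2 _))
    (lintegral_parabolicCylinder_half_fderiv_lt_top hreg hI hP)

/-- **Pineau–Vicol 2026, Prop. 9.5 for the solutions of Theorem 1.9, modulo the pressure class
and the smallness of the dissipation.** There is a universal `ε > 0` such that: every classical
solution `(u, p)` of Navier–Stokes (`ν = 1`, `f = 0`) on `[−1,0) × B₁` with the Type I bound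
(1.15) and the annular pressure bound (1.16), whose zoom by the factor `½`,
`(u_{1/2}, p_{1/2}) = (½ u(¼·, ½·), ¼ p(¼·, ½·))`, has `p_{1/2} ∈ L^{3/2}(Q₁)` (⇐ the pressure
decomposition of the proof of Prop. 9.5) and `sup_{0<r<1} r⁻¹∫∫_{Q_r}|∇u_{1/2}|² < ε` (⇐ (9.14)
via §9.3 and Lemma 9.4, then (9.15)–(9.16)), is bounded on `B_r × (−r², 0)` for some `r > 0` —
the conclusion of `pineauVicol2026_oneSlice_regularity`. Interior suitability, the classes
`u_{1/2} ∈ L^∞_t L²_x(Q₁)` and `∇u_{1/2} ∈ L²(Q₁)`, and the CKN step are proved. [cite: PineauVicol2026, Prop. 9.5 and its proof, arXiv:2607.09619 p. 32–33] -/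
theorem pineauVicol_regular_of_zoom_half :
    ∃ ε : ℝ, 0 < ε ∧
      ∀ (u : ℝ → EuclideanSpace ℝ (Fin 3) → EuclideanSpace ℝ (Fin 3))
        (p : ℝ → EuclideanSpace ℝ (Fin 3) → ℝ) (Cu Cp : ℝ),
        IsClassicalNSSolutionOnRegion
          (Ico (-1 : ℝ) 0 ×ˢ ball (0 : EuclideanSpace ℝ (Fin 3)) 1) 1 0 u p →
        (∀ t ∈ Ico (-1 : ℝ) 0, ∀ x ∈ ball (0 : EuclideanSpace ℝ (Fin 3)) 1,
          ‖u t x‖ ≤ Cu / (Real.sqrt (-t) + ‖x‖)) →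
        (∀ t ∈ Ico (-1 : ℝ) 0, ∀ x : EuclideanSpace ℝ (Fin 3),
          1 / 2 < ‖x‖ → ‖x‖ < 3 / 4 → |p t x| ≤ Cp) →
        MemLp (uncurry (nsRescalePressure (1 / 2) p)) (3 / 2)
          (volume.restrict (parabolicCylinder 1 (0 : ℝ × EuclideanSpace ℝ (Fin 3)))) →
        (⨆ r ∈ Ioo (0 : ℝ) 1,
          cknE r (0 : ℝ × EuclideanSpace ℝ (Fin 3))
            (fun t x => fderiv ℝ (nsRescale (1 / 2) u t) x)) < ENNReal.ofReal ε →
        ∃ r : ℝ, 0 < r ∧ ∃ M : ℝ, ∀ t : ℝ, -r ^ 2 < t → t < 0 →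
          ∀ x ∈ ball (0 : EuclideanSpace ℝ (Fin 3)) r, ‖u t x‖ ≤ M := by
  obtain ⟨ε, hε, H⟩ := pineauVicol_regular_of_zoom
  refine ⟨ε, hε, fun u p Cu Cp hreg hI hP hq hE => ?_⟩
  exact H u p Cu (1 / 2) hreg hI one_half_pos (by norm_num)
    (lintegral_parabolicCylinder_one_fderiv_nsRescale_lt_top hreg hI hP one_half_pos le_rfl) hq hE

end Literature.Analysis.FluidPDE

end
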